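import Mathlib.Analysis.SpecialFunctions.Pow.Real
import Mathlib.Analysis.SpecialFunctions.Pow.Continuity
import Mathlib.Analysis.SpecialFunctions.Log.Basic
import Mathlib.Analysis.SpecificLimits.Basic
import HarnessLib

/-!
# Madras's doubling trick: `Q_N² ≤ Q_{2N}` and `Q_n^{1/n} → λ` force `Q_N ≤ λ^N` for every `N`

Topic `Literature/Analysis/Asymptotics`. The analytic half of N. Madras's bounds on entropic critical
exponents (lattice animals and trees in `ℤ^d`: `a_N ≤ K λ^N N^{-(d-1)/d}`; self-avoiding polygons in
`ℤ²`: `p_n ≤ A n^{-1/2} μ^n`), as printed in the survey N. Madras, *Enumeration bounds via an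
isoperimetric-type inequality*, J. Phys.: Conf. Ser. 42 (2006) 213–220, §3 (held, open access;
`paper:madras2006-…` p0005:L66–p0006:L66), after the combinatorial step (3.5)
"`a_N² N^{(d-1)/d} ≤ a_{2N}` for every `N ≥ 1`":

> "The inequality (3.5) implies that `(N^{(d-1)/d} a_N)² ≤ (2N)^{(d-1)/d} a_{2N}` (3.6) for every
> `N ≥ 1`. Next, define `Q_n := n^{(d-1)/d} a_n` for `n = 1, 2, …` Then the inequality (3.6) says that
> `Q_N² ≤ Q_{2N}`, which we can rewrite as `Q_N^{1/N} ≤ Q_{2N}^{1/2N}`. Similarly, we have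
> `Q_{2N}^{1/2N} ≤ Q_{4N}^{1/4N}`, and so on. Therefore
> `Q_N^{1/N} ≤ Q_{2N}^{1/2N} ≤ Q_{4N}^{1/4N} ≤ Q_{8N}^{1/8N} ≤ …`; (3.7) thus we have found an
> increasing subsequence of the sequence `{Q_n^{1/n}}`. We know that `lim_{n→∞} Q_n^{1/n} =
> lim_{n→∞} a_n^{1/n} = λ` from Equation (3.1). Therefore `λ` is an upper bound of the increasing
> subsequence in (3.7). In particular, we deduce that the first term of the subsequence is less
> tha[n] `λ`: `Q_N^{1/N} ≤ λ`. Since `Q_N = N^{(d-1)/d} a_N`, we can rewrite the above inequality as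
> `a_N ≤ N^{-(d-1)/d} λ^N`, which is the desired result that `θ ≥ (d-1)/d`. See Madras (1995) for
> more details."

The original is N. Madras, *A rigorous bound on the critical exponent for the number of lattice
trees, animals, and polygons*, J. Stat. Phys. 78 (1995) 681–699 (not held; the termwise polygon bound
in `ℤ²` is there — the earlier N. Madras 1991 Spitzer-Festschrift chapter = Madras–Slade §8.1 has the
exponent only in generating-function form, cf. Madras–Slade §8.1 (held text p0202:L6): "we cannot prove that the
corresponding termwise upper bounds … hold"). Only the model-free analysis is vendored here; the
combinatorial inequality (3.5) (Loomis–Whitney + unique reconstruction at equal sizes) is the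
hypothesis `hsq`.

## Contents (namespace `Literature.Analysis.Asymptotics`; all PROVED, no definitions, no facts)

* `pow_two_pow_le_of_sq_le_double` — the iteration `Q_N^{2^k} ≤ Q_{2^k N}` of `Q_N² ≤ Q_{2N}`;
* **`Madras1995_doubling`** — `Q ≥ 0`, `Q_N² ≤ Q_{2N}` (`N ≥ 1`), `Q_n^{1/n} → λ` ⇒ `Q_N ≤ λ^N` for
  every `N ≥ 1` (the printed (3.7) argument, run as `Q_N ≤ (Q_{2^k N}^{1/(2^k N)})^N → λ^N`);
* `tendsto_rpow_const_rpow_inv_nat` — `(n^θ)^{1/n} → 1`;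
* **`Madras1995_doubling_polynomial`** — the printed shape with the polynomial weight: `a ≥ 0`,
  `(N^θ a_N)² ≤ (2N)^θ a_{2N}` (`N ≥ 1`, i.e. (3.6) with `θ = (d-1)/d`), `a_n^{1/n} → λ` ⇒
  `a_N ≤ N^{-θ} λ^N` for every `N ≥ 1` (constant `K = 1`).

Design: limits are real `rpow`s `x ^ (1 / (n : ℝ))` as elsewhere in the tree
(`SAW.Zd.tendsto_bridgeCount_rpow`); "`lim Q_n^{1/n} = λ`" is a `Tendsto` hypothesis (only the
subsequence `n = 2^k N` is used, so `limsup ≤ λ` would suffice — not weakened here, AS PRINTED).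
-/

noncomputable section

open Filter
open scoped Topology

namespace Literature.Analysis.Asymptotics

/-- The doubling iteration: from `Q_N² ≤ Q_{2N}` (`N ≥ 1`, `Q ≥ 0`) to `Q_N^{2^k} ≤ Q_{2^k N}`
("`Q_N^{1/N} ≤ Q_{2N}^{1/2N} ≤ Q_{4N}^{1/4N} ≤ …`"). [cite: Madras2006Isoperimetric, §3, eq. (3.7)] -/
theorem pow_two_pow_le_of_sq_le_double {Q : ℕ → ℝ} (hQ0 : ∀ n, 1 ≤ n → 0 ≤ Q n)
    (hsq : ∀ N, 1 ≤ N → Q N ^ 2 ≤ Q (2 * N)) {N : ℕ} (hN : 1 ≤ N) (k : ℕ) :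
    Q N ^ (2 ^ k) ≤ Q (2 ^ k * N) := by
  induction k with
  | zero => simp
  | succ k ih =>
    have h1 : 1 ≤ 2 ^ k * N := Nat.le_of_lt_succ (by
      have := Nat.one_le_two_pow (n := k); nlinarith)
    calc Q N ^ (2 ^ (k + 1)) = (Q N ^ (2 ^ k)) ^ 2 := by rw [pow_succ, pow_mul]
      _ ≤ Q (2 ^ k * N) ^ 2 := pow_le_pow_left₀ (pow_nonneg (hQ0 N hN) _) ih 2
      _ ≤ Q (2 * (2 ^ k * N)) := hsq _ h1
      _ = Q (2 ^ (k + 1) * N) := by rw [pow_succ]; ring_nf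

/-- **Madras's doubling trick** (the analysis of Madras 1995, as printed in Madras 2006, §3,
(3.6)–(3.7)): if `Q_n ≥ 0`, `Q_N² ≤ Q_{2N}` for every `N ≥ 1`, and `Q_n^{1/n} → λ`, then
`Q_N ≤ λ^N` for every `N ≥ 1` ("`λ` is an upper bound of the increasing subsequence (3.7) … the
first term of the subsequence is less tha[n] `λ`: `Q_N^{1/N} ≤ λ`").
[cite: Madras2006Isoperimetric, §3, eqs. (3.6)–(3.7) (p. 217); Madras1995LatticeAnimalsExponent] -/
theorem Madras1995_doubling {Q : ℕ → ℝ} {lam : ℝ} (hQ0 : ∀ n, 1 ≤ n → 0 ≤ Q n)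
    (hsq : ∀ N, 1 ≤ N → Q N ^ 2 ≤ Q (2 * N))
    (hlim : Tendsto (fun n : ℕ => Q n ^ (1 / (n : ℝ))) atTop (𝓝 lam)) {N : ℕ} (hN : 1 ≤ N) :
    Q N ≤ lam ^ N := by
  -- the subsequence `n_k = 2^k N → ∞`
  have hsub : Tendsto (fun k : ℕ => 2 ^ k * N) atTop atTop := by
    refine tendsto_atTop_mono (fun k => ?_) (tendsto_pow_atTop_atTop_of_one_lt one_lt_two)
    exact Nat.le_mul_of_pos_right _ (by omega)
  -- `(Q_{n_k}^{1/n_k})^N → λ^N`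
  have hlimN : Tendsto (fun k : ℕ => (Q (2 ^ k * N) ^ (1 / ((2 ^ k * N : ℕ) : ℝ))) ^ N) atTop
      (𝓝 (lam ^ N)) := ((hlim.comp hsub).pow N).congr (fun k => rfl)
  refine ge_of_tendsto' hlimN fun k => ?_
  -- `Q_N ≤ Q_{n_k}^{1/2^k} = (Q_{n_k}^{1/n_k})^N`
  have hQN : 0 ≤ Q N := hQ0 N hN
  have hnk1 : 1 ≤ 2 ^ k * N := le_trans hN (Nat.le_mul_of_pos_left _ (Nat.one_le_two_pow))
  have hQk : 0 ≤ Q (2 ^ k * N) := hQ0 _ hnk1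
  have hpk : (0 : ℝ) < (2 : ℝ) ^ k := by positivity
  have hNr : (0 : ℝ) < N := by exact_mod_cast hN
  have step1 : Q N = (Q N ^ (2 ^ k)) ^ (1 / ((2 : ℝ) ^ k)) := by
    rw [← Real.rpow_natCast (Q N) (2 ^ k), ← Real.rpow_mul hQN]
    push_cast
    rw [mul_one_div_cancel hpk.ne', Real.rpow_one]
  have step2 : (Q N ^ (2 ^ k)) ^ (1 / ((2 : ℝ) ^ k)) ≤ Q (2 ^ k * N) ^ (1 / ((2 : ℝ) ^ k)) :=
    Real.rpow_le_rpow (pow_nonneg hQN _) (pow_two_pow_le_of_sq_le_double hQ0 hsq hN k)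
      (by positivity)
  have step3 : Q (2 ^ k * N) ^ (1 / ((2 : ℝ) ^ k)) =
      (Q (2 ^ k * N) ^ (1 / ((2 ^ k * N : ℕ) : ℝ))) ^ N := by
    rw [← Real.rpow_natCast (Q (2 ^ k * N) ^ (1 / ((2 ^ k * N : ℕ) : ℝ))) N, ← Real.rpow_mul hQk]
    congr 1
    push_cast
    field_simp
  calc Q N = (Q N ^ (2 ^ k)) ^ (1 / ((2 : ℝ) ^ k)) := step1
    _ ≤ Q (2 ^ k * N) ^ (1 / ((2 : ℝ) ^ k)) := step2
    _ = (Q (2 ^ k * N) ^ (1 / ((2 ^ k * N : ℕ) : ℝ))) ^ N := step3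

/-- `(n^θ)^{1/n} → 1` as `n → ∞` (`θ` fixed): `= exp(θ log n / n)` and `log n / n → 0`.
[cite: Madras2006Isoperimetric, §3 ("lim Q_n^{1/n} = lim a_n^{1/n}")] -/
theorem tendsto_rpow_const_rpow_inv_nat (θ : ℝ) :
    Tendsto (fun n : ℕ => ((n : ℝ) ^ θ) ^ (1 / (n : ℝ))) atTop (𝓝 1) := by
  -- `θ · (log n / n) → 0`, then exponentiate
  have hlog : Tendsto (fun n : ℕ => Real.log (n : ℝ) / n) atTop (𝓝 0) := by
    have h := (Real.tendsto_pow_log_div_mul_add_atTop 1 0 1 one_ne_zero).comp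
      tendsto_natCast_atTop_atTop
    refine h.congr' (Eventually.of_forall fun n => ?_)
    simp [Function.comp]
  have hexp : Tendsto (fun n : ℕ => Real.exp (θ * (Real.log (n : ℝ) / n))) atTop (𝓝 1) := by
    have := (Real.continuous_exp.tendsto _).comp (hlog.const_mul θ)
    rwa [mul_zero, Real.exp_zero] at this
  refine hexp.congr' ?_
  filter_upwards [eventually_ge_atTop 1] with n hn
  have hn : (0 : ℝ) < n := by exact_mod_cast hn
  rw [← Real.rpow_mul hn.le, Real.rpow_def_of_pos hn]
  congr 1
  ring

/-- **Madras's entropic-exponent bound from the doubling inequality** (as printed, constant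
`K = 1`): if `a_n ≥ 0`, `(N^θ a_N)² ≤ (2N)^θ a_{2N}` for every `N ≥ 1` ((3.6); for lattice
animals `θ = (d-1)/d` by the Loomis–Whitney inequality and (3.5) `a_N² N^{(d-1)/d} ≤ a_{2N}`), and
`a_n^{1/n} → λ`, then `a_N ≤ N^{-θ} λ^N` for every `N ≥ 1` ("which is the desired result that
`θ ≥ (d-1)/d`"). [cite: Madras2006Isoperimetric, §3, eqs. (3.4)–(3.7); Madras1995LatticeAnimalsExponent] -/
theorem Madras1995_doubling_polynomial {a : ℕ → ℝ} {θ lam : ℝ} (ha0 : ∀ n, 1 ≤ n → 0 ≤ a n)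
    (hsq : ∀ N : ℕ, 1 ≤ N → (((N : ℝ) ^ θ) * a N) ^ 2 ≤ ((2 * N : ℕ) : ℝ) ^ θ * a (2 * N))
    (hlim : Tendsto (fun n : ℕ => a n ^ (1 / (n : ℝ))) atTop (𝓝 lam)) {N : ℕ} (hN : 1 ≤ N) :
    a N ≤ (N : ℝ) ^ (-θ) * lam ^ N := by
  -- `Q_n := n^θ a_n`
  set Q : ℕ → ℝ := fun n => ((n : ℝ) ^ θ) * a n with hQdef
  have hQ0 : ∀ n, 1 ≤ n → 0 ≤ Q n := fun n hn =>
    mul_nonneg (Real.rpow_nonneg (Nat.cast_nonneg _) _) (ha0 n hn)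
  have hsq' : ∀ N, 1 ≤ N → Q N ^ 2 ≤ Q (2 * N) := fun N hN => by
    simp only [hQdef]
    exact hsq N hN
  -- `Q_n^{1/n} = (n^θ)^{1/n} a_n^{1/n} → 1 · λ`
  have hlimQ : Tendsto (fun n : ℕ => Q n ^ (1 / (n : ℝ))) atTop (𝓝 lam) := by
    have h := (tendsto_rpow_const_rpow_inv_nat θ).mul hlim
    rw [one_mul] at h
    refine h.congr' ?_
    filter_upwards [eventually_ge_atTop 1] with n hn
    rw [hQdef, Real.mul_rpow (Real.rpow_nonneg (Nat.cast_nonneg _) _) (ha0 n hn)]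
  have hmain := Madras1995_doubling hQ0 hsq' hlimQ hN
  -- unfold `Q_N = N^θ a_N` and divide
  have hNr : (0 : ℝ) < N := by exact_mod_cast hN
  have hNθ : 0 < (N : ℝ) ^ θ := Real.rpow_pos_of_pos hNr θ
  simp only [hQdef] at hmain
  rw [Real.rpow_neg hNr.le, ← div_eq_inv_mul, le_div_iff₀ hNθ, mul_comm]
  exact hmain

end Literature.Analysis.Asymptotics

end
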